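import Summits.QuantumFields.YangMills.Theorems.AllWindowsColdBoxBoxHighLineRestrictionMoments

/-!
# U5 ε₂-glue (G2b), 13r³: the D-TRUNCATION TRANSFER `μ_D ↔ E₀` for the third cumulant at `t = 0`, with MOMENT hypotheses

Free-hands helper of the κ-lineage (ym-line-fcl-p3 g27) for the ε₂-half of the NEXT rung U5 (`stub_landauThirdOrder`, LINE-20,
⟨stmt-QuantumFields-24336⟩).  Planner ym-idea-2 g18's `Cruxes/BoxWindowHighSU2213/U5-BLOCKERS.md` §2 L2: «`f′(0) = κ₃,₀(c₀, c_T, U)` at the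
Gaussian restricted to `D`; up to the D-truncation (exponentially small) it is a finite sum of CONNECTED pairings»; LEAD ym-line-sfw-p2 g78
(2026-08-29T22:50:14Z) and w3 g41 (22:35:16Z): the D-truncation transfer is NOT in their L2/L3 files.  This file supplies it for `κ₃,₀`, over
✓`…RestrictionMoments` (single-average transfer), in the cell's `gaussAvg` letters (`E₀ = gaussAvg β H`, `1_D = sfInd H s`, `D = smallField H s`,
`μ_D := (volume.restrict D).withDensity (ofReal ∘ gaussWeight β H)`):

* §2 pure-real bookkeeping `abs_mul_sub_mul_le_of`, `abs_mul3_sub_mul3_le_of`, `cum3_transfer_arith`;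
* §3 ★★ `abs_tiltCum3_muD_zero_sub_gaussCum3_le` — for measurable `G₁, G₂, P` bounded by `B` on `D`, with SIXTH moments under `E₀`
  (`Integrable (Gᵢ⁶·gaussWeight)`, `Integrable (P⁶·gaussWeight)` — so POLYNOMIAL slots are admissible) and raw second-moment sizes
  `E₀[G₁²] ≤ A₁, E₀[G₂²] ≤ A₂, E₀[P²] ≤ A₃, E₀[(G₁G₂)²] ≤ A₁₂, E₀[(G₁P)²] ≤ A₁₃, E₀[(G₂P)²] ≤ A₂₃, E₀[(G₁G₂P)²] ≤ A₁₂₃`: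
  `|Tilt.tiltCum3 μ_D P 0 G₁ G₂ − (E₀[G₁G₂P] − E₀G₁·E₀[G₂P] − E₀G₂·E₀[G₁P] − E₀P·E₀[G₁G₂] + 2·(E₀G₁·E₀G₂·E₀P))|`
  `≤ √τ · (4√A₁₂₃ + 12(√A₃√A₁₂ + √A₂√A₁₃ + √A₁√A₂₃) + 56·(√A₁√A₂√A₃))`,
  the subtracted expression being the LHS of w3 g41's ✓`gaussCum3_quadVal` (slots `A ↦ G₁, B ↦ G₂, M ↦ P`) token for token.  With ✓6g
  (`τ = 1296·H⁴·e^{−cβs²}`) every admissible size is polynomial in `H, β`, so the transfer error is `e^{−cβ^{2κ₃}/2}`-small on U5's window.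
  Proof: a.e.-congruence to the `D`-truncations (✓`Tilt.tiltCum3_congr_ae`), ✓`Tilt.tiltCum3_eq_raw` on `μ_D`, ✓`Tilt.tiltExp_muD_zero_eq`, then
  the single-average transfer monomial by monomial.

No definitions; standard axioms.  HONEST LABEL: helper-grade glue for U5 prep; U5, ⟨24004⟩, ⟨24336⟩ remain OPEN; route AllWindowsColdBox is DRAFT;
no crux, rung or summit is proved; the Yang–Mills mass gap is NOT proved by this file; no summit is proved by a line.
-/

set_option autoImplicit false

noncomputable section

open MeasureTheory Set

namespace Summit.QuantumFields.YangMills.Theorems.AllWindowsColdBoxBoxHighLine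

namespace GaussRestrict

variable {H : ℕ} {β : ℝ}

/-! ## §2 Pure-real bookkeeping -/

/-- `|ab − cd| ≤ δa·Bb + Bc·δb` from `|a − c| ≤ δa`, `|b| ≤ Bb`, `|c| ≤ Bc`, `|b − d| ≤ δb`. -/
theorem abs_mul_sub_mul_le_of {a b c d δa Bb Bc δb : ℝ} (h1 : |a - c| ≤ δa) (h2 : |b| ≤ Bb) (h3 : |c| ≤ Bc) (h4 : |b - d| ≤ δb) :
    |a * b - c * d| ≤ δa * Bb + Bc * δb := by
  have e : a * b - c * d = (a - c) * b + c * (b - d) := by ring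
  rw [e]
  calc |(a - c) * b + c * (b - d)| ≤ |(a - c) * b| + |c * (b - d)| := abs_add_le _ _
    _ = |a - c| * |b| + |c| * |b - d| := by rw [abs_mul, abs_mul]
    _ ≤ δa * Bb + Bc * δb := add_le_add (mul_le_mul h1 h2 (abs_nonneg _) ((abs_nonneg _).trans h1))
        (mul_le_mul h3 h4 (abs_nonneg _) ((abs_nonneg _).trans h3))

/-- `|abc − a′b′c′| ≤ δa·Bb·Bc + Ba′·δb·Bc + Ba′·Bb′·δc`. -/
theorem abs_mul3_sub_mul3_le_of {a b c a' b' c' δa δb δc Bb Bc Ba' Bb' : ℝ} (ha : |a - a'| ≤ δa) (hb : |b - b'| ≤ δb)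
    (hc : |c - c'| ≤ δc) (hBb : |b| ≤ Bb) (hBc : |c| ≤ Bc) (hBa' : |a'| ≤ Ba') (hBb' : |b'| ≤ Bb') :
    |a * b * c - a' * b' * c'| ≤ δa * Bb * Bc + Ba' * δb * Bc + Ba' * Bb' * δc := by
  have e : a * b * c - a' * b' * c' = (a - a') * b * c + a' * (b - b') * c + a' * b' * (c - c') := by ring
  rw [e]
  have t1 : |(a - a') * b * c| ≤ δa * Bb * Bc := by
    rw [abs_mul, abs_mul]
    exact mul_le_mul (mul_le_mul ha hBb (abs_nonneg _) ((abs_nonneg _).trans ha)) hBc (abs_nonneg _)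
      (mul_nonneg ((abs_nonneg _).trans ha) ((abs_nonneg _).trans hBb))
  have t2 : |a' * (b - b') * c| ≤ Ba' * δb * Bc := by
    rw [abs_mul, abs_mul]
    exact mul_le_mul (mul_le_mul hBa' hb (abs_nonneg _) ((abs_nonneg _).trans hBa')) hBc (abs_nonneg _)
      (mul_nonneg ((abs_nonneg _).trans hBa') ((abs_nonneg _).trans hb))
  have t3 : |a' * b' * (c - c')| ≤ Ba' * Bb' * δc := by
    rw [abs_mul, abs_mul]
    exact mul_le_mul (mul_le_mul hBa' hBb' (abs_nonneg _) ((abs_nonneg _).trans hBa')) hc (abs_nonneg _)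
      (mul_nonneg ((abs_nonneg _).trans hBa') ((abs_nonneg _).trans hBb'))
  calc |(a - a') * b * c + a' * (b - b') * c + a' * b' * (c - c')|
      ≤ |(a - a') * b * c + a' * (b - b') * c| + |a' * b' * (c - c')| := abs_add_le _ _
    _ ≤ |(a - a') * b * c| + |a' * (b - b') * c| + |a' * b' * (c - c')| := add_le_add (abs_add_le _ _) le_rfl
    _ ≤ _ := by linarith

/-- ★ **The κ₃ transfer arithmetic.**  Restricted raw moments `r`, full raw moments `e`, sizes `A` (through their square roots `S_V = √A_V`):
from `|r_V − e_V| ≤ 4η·S_V`, `|r_V| ≤ 2·S_V`, `|e_V| ≤ S_V` the two raw third-cumulant expressions differ by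
`≤ η·(4·S₁₂₃ + 12(S₃S₁₂ + S₂S₁₃ + S₁S₂₃) + 56·S₁S₂S₃)`. -/
theorem cum3_transfer_arith {η S₁ S₂ S₃ S₁₂ S₁₃ S₂₃ S₁₂₃ r₁ r₂ r₃ r₁₂ r₁₃ r₂₃ r₁₂₃ e₁ e₂ e₃ e₁₂ e₁₃ e₂₃ e₁₂₃ : ℝ}
    (d₁ : |r₁ - e₁| ≤ 4 * η * S₁) (d₂ : |r₂ - e₂| ≤ 4 * η * S₂) (d₃ : |r₃ - e₃| ≤ 4 * η * S₃) (d₁₂ : |r₁₂ - e₁₂| ≤ 4 * η * S₁₂)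
    (d₁₃ : |r₁₃ - e₁₃| ≤ 4 * η * S₁₃) (d₂₃ : |r₂₃ - e₂₃| ≤ 4 * η * S₂₃) (d₁₂₃ : |r₁₂₃ - e₁₂₃| ≤ 4 * η * S₁₂₃)
    (b₂ : |r₂| ≤ 2 * S₂) (b₃ : |r₃| ≤ 2 * S₃) (b₁₂ : |r₁₂| ≤ 2 * S₁₂) (b₁₃ : |r₁₃| ≤ 2 * S₁₃) (b₂₃ : |r₂₃| ≤ 2 * S₂₃)
    (c₁ : |e₁| ≤ S₁) (c₂ : |e₂| ≤ S₂) (c₃ : |e₃| ≤ S₃) :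
    |(r₁₂₃ - r₃ * r₁₂ - r₂ * r₁₃ - r₁ * r₂₃ + 2 * (r₁ * r₂ * r₃)) -
        (e₁₂₃ - e₁ * e₂₃ - e₂ * e₁₃ - e₃ * e₁₂ + 2 * (e₁ * e₂ * e₃))| ≤
      η * (4 * S₁₂₃ + 12 * (S₃ * S₁₂ + S₂ * S₁₃ + S₁ * S₂₃) + 56 * (S₁ * S₂ * S₃)) := by
  have t3 := abs_mul_sub_mul_le_of d₃ b₁₂ c₃ d₁₂
  have t2 := abs_mul_sub_mul_le_of d₂ b₁₃ c₂ d₁₃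
  have t1 := abs_mul_sub_mul_le_of d₁ b₂₃ c₁ d₂₃
  have t0 := abs_mul3_sub_mul3_le_of d₁ d₂ d₃ b₂ b₃ c₁ c₂
  obtain ⟨l123, u123⟩ := abs_le.1 d₁₂₃
  obtain ⟨l3, u3⟩ := abs_le.1 t3
  obtain ⟨l2, u2⟩ := abs_le.1 t2
  obtain ⟨l1, u1⟩ := abs_le.1 t1
  obtain ⟨l0, u0⟩ := abs_le.1 t0
  rw [abs_le]
  constructor <;> nlinarith [l123, u123, l3, u3, l2, u2, l1, u1, l0, u0]

/-! ## §3 The third-cumulant transfer `μ_D ↔ E₀` -/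

/-- ★★ **D-TRUNCATION TRANSFER FOR `κ₃,₀`.**  `E₀[1 − 1_D] ≤ τ ≤ 1/2`; `G₁, G₂, P` measurable, bounded by `B` on `D = smallField H s`, with sixth
moments under `E₀`; raw second-moment sizes `A_V ≥ E₀[V²]` for the seven monomials.  Then the third cumulant at `t = 0` over `μ_D` (any tilt letter,
here `P`) differs from the raw Gaussian third-cumulant expression (the LHS of ✓`gaussCum3_quadVal`, slots `G₁, G₂, P`) by
`≤ √τ·(4√A₁₂₃ + 12(√A₃√A₁₂ + √A₂√A₁₃ + √A₁√A₂₃) + 56·√A₁√A₂√A₃)`. -/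
theorem abs_tiltCum3_muD_zero_sub_gaussCum3_le (hβ : 0 < β) (s : ℝ) {τ : ℝ} (hτ : gaussAvg β H (fun a => 1 - sfInd H s a) ≤ τ)
    (hτ2 : τ ≤ 1 / 2) {G₁ G₂ P : (LandauFree H → E3) → ℝ} (h₁ : Measurable G₁) (h₂ : Measurable G₂) (hP : Measurable P) {B : ℝ}
    (hB : 0 ≤ B) (h₁D : ∀ a ∈ smallField H s, |G₁ a| ≤ B) (h₂D : ∀ a ∈ smallField H s, |G₂ a| ≤ B)
    (hPD : ∀ a ∈ smallField H s, |P a| ≤ B) (i₁ : Integrable (fun a => G₁ a ^ 6 * gaussWeight β H a))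
    (i₂ : Integrable (fun a => G₂ a ^ 6 * gaussWeight β H a)) (iP : Integrable (fun a => P a ^ 6 * gaussWeight β H a))
    {A₁ A₂ A₃ A₁₂ A₁₃ A₂₃ A₁₂₃ : ℝ} (hA₁ : gaussAvg β H (fun a => G₁ a ^ 2) ≤ A₁) (hA₂ : gaussAvg β H (fun a => G₂ a ^ 2) ≤ A₂)
    (hA₃ : gaussAvg β H (fun a => P a ^ 2) ≤ A₃) (hA₁₂ : gaussAvg β H (fun a => (G₁ a * G₂ a) ^ 2) ≤ A₁₂)
    (hA₁₃ : gaussAvg β H (fun a => (G₁ a * P a) ^ 2) ≤ A₁₃) (hA₂₃ : gaussAvg β H (fun a => (G₂ a * P a) ^ 2) ≤ A₂₃)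
    (hA₁₂₃ : gaussAvg β H (fun a => (G₁ a * G₂ a * P a) ^ 2) ≤ A₁₂₃) :
    |Tilt.tiltCum3 (((volume : Measure (LandauFree H → E3)).restrict (smallField H s)).withDensity fun a => ENNReal.ofReal (gaussWeight β H a))
          P 0 G₁ G₂ -
        (gaussAvg β H (fun a => G₁ a * G₂ a * P a) - gaussAvg β H G₁ * gaussAvg β H (fun a => G₂ a * P a) -
          gaussAvg β H G₂ * gaussAvg β H (fun a => G₁ a * P a) - gaussAvg β H P * gaussAvg β H (fun a => G₁ a * G₂ a) +
          2 * (gaussAvg β H G₁ * gaussAvg β H G₂ * gaussAvg β H P))| ≤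
      Real.sqrt τ * (4 * Real.sqrt A₁₂₃ + 12 * (Real.sqrt A₃ * Real.sqrt A₁₂ + Real.sqrt A₂ * Real.sqrt A₁₃ + Real.sqrt A₁ * Real.sqrt A₂₃) +
        56 * (Real.sqrt A₁ * Real.sqrt A₂ * Real.sqrt A₃)) := by
  -- the D-mass and the instances
  have hD := integral_sfInd_mul_gaussWeight_pos hβ s hτ hτ2
  haveI := Tilt.isFiniteMeasure_muD H hβ s
  haveI := Tilt.neZero_muD H hβ hD
  -- truncations: bounded measurable, a.e. equal to the originals
  have m₁' : Measurable fun a => sfInd H s a * G₁ a := (Tilt.measurable_sfInd H s).mul h₁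
  have m₂' : Measurable fun a => sfInd H s a * G₂ a := (Tilt.measurable_sfInd H s).mul h₂
  have mP' : Measurable fun a => sfInd H s a * P a := (Tilt.measurable_sfInd H s).mul hP
  have b₁' : ∀ a, |sfInd H s a * G₁ a| ≤ B := fun a => Tilt.abs_sfInd_mul_le H hB h₁D a
  have b₂' : ∀ a, |sfInd H s a * G₂ a| ≤ B := fun a => Tilt.abs_sfInd_mul_le H hB h₂D a
  have bP' : ∀ a, |sfInd H s a * P a| ≤ B := fun a => Tilt.abs_sfInd_mul_le H hB hPD a
  have hc := Tilt.tiltCum3_congr_ae (ae_muD_eq_sfInd_mul β s P) (ae_muD_eq_sfInd_mul β s G₁) (ae_muD_eq_sfInd_mul β s G₂) (0 : ℝ)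
  rw [hc, Tilt.tiltCum3_eq_raw mP' m₁' m₂' bP' b₁' b₂' 0]
  simp only [Tilt.tiltExp_muD_zero_eq H hβ s]
  -- the products of truncations are the truncated products
  have e123 : (fun a => sfInd H s a * (sfInd H s a * G₁ a * (sfInd H s a * G₂ a) * (sfInd H s a * P a))) =
      fun a => sfInd H s a * (G₁ a * G₂ a * P a) :=
    sfInd_mul_congr_on fun a ha => by simp only [sfInd_mul_eq_on _ ha]
  have e12 : (fun a => sfInd H s a * (sfInd H s a * G₁ a * (sfInd H s a * G₂ a))) = fun a => sfInd H s a * (G₁ a * G₂ a) :=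
    sfInd_mul_congr_on fun a ha => by simp only [sfInd_mul_eq_on _ ha]
  have e13 : (fun a => sfInd H s a * (sfInd H s a * G₁ a * (sfInd H s a * P a))) = fun a => sfInd H s a * (G₁ a * P a) :=
    sfInd_mul_congr_on fun a ha => by simp only [sfInd_mul_eq_on _ ha]
  have e23 : (fun a => sfInd H s a * (sfInd H s a * G₂ a * (sfInd H s a * P a))) = fun a => sfInd H s a * (G₂ a * P a) :=
    sfInd_mul_congr_on fun a ha => by simp only [sfInd_mul_eq_on _ ha]
  have e1 : (fun a => sfInd H s a * (sfInd H s a * G₁ a)) = fun a => sfInd H s a * G₁ a :=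
    sfInd_mul_congr_on fun a ha => by simp only [sfInd_mul_eq_on _ ha]
  have e2 : (fun a => sfInd H s a * (sfInd H s a * G₂ a)) = fun a => sfInd H s a * G₂ a :=
    sfInd_mul_congr_on fun a ha => by simp only [sfInd_mul_eq_on _ ha]
  have e3 : (fun a => sfInd H s a * (sfInd H s a * P a)) = fun a => sfInd H s a * P a :=
    sfInd_mul_congr_on fun a ha => by simp only [sfInd_mul_eq_on _ ha]
  rw [e123, e12, e13, e23, e1, e2, e3]
  -- square-integrability of the seven monomials
  have q₁ := integrable_sq_mul_gaussWeight_of_six hβ h₁ i₁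
  have q₂ := integrable_sq_mul_gaussWeight_of_six hβ h₂ i₂
  have q₃ := integrable_sq_mul_gaussWeight_of_six hβ hP iP
  have q₁₂ := integrable_sq_mul2_mul_gaussWeight hβ h₁ h₂ i₁ i₂
  have q₁₃ := integrable_sq_mul2_mul_gaussWeight hβ h₁ hP i₁ iP
  have q₂₃ := integrable_sq_mul2_mul_gaussWeight hβ h₂ hP i₂ iP
  have q₁₂₃ := integrable_sq_mul3_mul_gaussWeight hβ h₁ h₂ hP i₁ i₂ iP
  -- the transfer of each monomial, and the sizes
  have d₁ := abs_rD_sub_gaussAvg_le_of_sq_le hβ s hτ hτ2 h₁ q₁ hA₁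
  have d₂ := abs_rD_sub_gaussAvg_le_of_sq_le hβ s hτ hτ2 h₂ q₂ hA₂
  have d₃ := abs_rD_sub_gaussAvg_le_of_sq_le hβ s hτ hτ2 hP q₃ hA₃
  have d₁₂ := abs_rD_sub_gaussAvg_le_of_sq_le hβ s hτ hτ2 (h₁.mul h₂) q₁₂ hA₁₂
  have d₁₃ := abs_rD_sub_gaussAvg_le_of_sq_le hβ s hτ hτ2 (h₁.mul hP) q₁₃ hA₁₃
  have d₂₃ := abs_rD_sub_gaussAvg_le_of_sq_le hβ s hτ hτ2 (h₂.mul hP) q₂₃ hA₂₃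
  have d₁₂₃ := abs_rD_sub_gaussAvg_le_of_sq_le hβ s hτ hτ2 ((h₁.mul h₂).mul hP) q₁₂₃ hA₁₂₃
  have b₂ := (abs_rD_le hβ s hτ hτ2 h₂ q₂).trans (mul_le_mul_of_nonneg_left (Real.sqrt_le_sqrt hA₂) (by norm_num))
  have b₃ := (abs_rD_le hβ s hτ hτ2 hP q₃).trans (mul_le_mul_of_nonneg_left (Real.sqrt_le_sqrt hA₃) (by norm_num))
  have b₁₂ := (abs_rD_le hβ s hτ hτ2 (h₁.mul h₂) q₁₂).trans (mul_le_mul_of_nonneg_left (Real.sqrt_le_sqrt hA₁₂) (by norm_num))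
  have b₁₃ := (abs_rD_le hβ s hτ hτ2 (h₁.mul hP) q₁₃).trans (mul_le_mul_of_nonneg_left (Real.sqrt_le_sqrt hA₁₃) (by norm_num))
  have b₂₃ := (abs_rD_le hβ s hτ hτ2 (h₂.mul hP) q₂₃).trans (mul_le_mul_of_nonneg_left (Real.sqrt_le_sqrt hA₂₃) (by norm_num))
  have c₁ := (abs_gaussAvg_le_sqrt_sq hβ h₁ q₁).trans (Real.sqrt_le_sqrt hA₁)
  have c₂ := (abs_gaussAvg_le_sqrt_sq hβ h₂ q₂).trans (Real.sqrt_le_sqrt hA₂)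
  have c₃ := (abs_gaussAvg_le_sqrt_sq hβ hP q₃).trans (Real.sqrt_le_sqrt hA₃)
  exact cum3_transfer_arith d₁ d₂ d₃ d₁₂ d₁₃ d₂₃ d₁₂₃ b₂ b₃ b₁₂ b₁₃ b₂₃ c₁ c₂ c₃

/-! ## §4 Re-centring at the full Gaussian means: the CENTRED form of the transfer -/

/-- **Shift invariance of `κ₃,₀` over `μ_D`** for observables bounded on `D` (any constants; `0 < ∫ 1_D·gaussWeight`): both the two slots and the
tilt letter may be re-centred (✓`Tilt.tiltCum3_shift`/`shiftU` on the `D`-truncations, transported by a.e.-congruence). -/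
theorem tiltCum3_muD_zero_shift (hβ : 0 < β) (s : ℝ) (hD : 0 < ∫ a, sfInd H s a * gaussWeight β H a)
    {G₁ G₂ P : (LandauFree H → E3) → ℝ} (h₁ : Measurable G₁) (h₂ : Measurable G₂) (hP : Measurable P) {B : ℝ} (hB : 0 ≤ B)
    (h₁D : ∀ a ∈ smallField H s, |G₁ a| ≤ B) (h₂D : ∀ a ∈ smallField H s, |G₂ a| ≤ B) (hPD : ∀ a ∈ smallField H s, |P a| ≤ B)
    (c₁ c₂ c₃ : ℝ) :
    Tilt.tiltCum3 (((volume : Measure (LandauFree H → E3)).restrict (smallField H s)).withDensity fun a => ENNReal.ofReal (gaussWeight β H a))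
        P 0 G₁ G₂ =
      Tilt.tiltCum3 (((volume : Measure (LandauFree H → E3)).restrict (smallField H s)).withDensity fun a => ENNReal.ofReal (gaussWeight β H a))
        (fun a => P a - c₃) 0 (fun a => G₁ a - c₁) (fun a => G₂ a - c₂) := by
  haveI := Tilt.isFiniteMeasure_muD H hβ s
  haveI := Tilt.neZero_muD H hβ hD
  have m₁' : Measurable fun a => sfInd H s a * G₁ a := (Tilt.measurable_sfInd H s).mul h₁
  have m₂' : Measurable fun a => sfInd H s a * G₂ a := (Tilt.measurable_sfInd H s).mul h₂
  have mP' : Measurable fun a => sfInd H s a * P a := (Tilt.measurable_sfInd H s).mul hP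
  have b₁' : ∀ a, |sfInd H s a * G₁ a| ≤ B := fun a => Tilt.abs_sfInd_mul_le H hB h₁D a
  have b₂' : ∀ a, |sfInd H s a * G₂ a| ≤ B := fun a => Tilt.abs_sfInd_mul_le H hB h₂D a
  have bP' : ∀ a, |sfInd H s a * P a| ≤ B := fun a => Tilt.abs_sfInd_mul_le H hB hPD a
  -- both sides through the truncations
  have hL := Tilt.tiltCum3_congr_ae (ae_muD_eq_sfInd_mul β s P) (ae_muD_eq_sfInd_mul β s G₁) (ae_muD_eq_sfInd_mul β s G₂) (0 : ℝ)
  have aP : (fun a => P a - c₃) =ᵐ[((volume : Measure (LandauFree H → E3)).restrict (smallField H s)).withDensity fun a =>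
      ENNReal.ofReal (gaussWeight β H a)] fun a => sfInd H s a * P a - c₃ := by
    filter_upwards [Tilt.ae_muD_mem_smallField H β s] with a ha
    rw [sfInd_mul_eq_on P ha]
  have a₁ : (fun a => G₁ a - c₁) =ᵐ[((volume : Measure (LandauFree H → E3)).restrict (smallField H s)).withDensity fun a =>
      ENNReal.ofReal (gaussWeight β H a)] fun a => sfInd H s a * G₁ a - c₁ := by
    filter_upwards [Tilt.ae_muD_mem_smallField H β s] with a ha
    rw [sfInd_mul_eq_on G₁ ha]
  have a₂ : (fun a => G₂ a - c₂) =ᵐ[((volume : Measure (LandauFree H → E3)).restrict (smallField H s)).withDensity fun a =>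
      ENNReal.ofReal (gaussWeight β H a)] fun a => sfInd H s a * G₂ a - c₂ := by
    filter_upwards [Tilt.ae_muD_mem_smallField H β s] with a ha
    rw [sfInd_mul_eq_on G₂ ha]
  have hR := Tilt.tiltCum3_congr_ae aP a₁ a₂ (0 : ℝ)
  rw [hL, hR, Tilt.tiltCum3_shiftU mP' bP' c₃ 0, Tilt.tiltCum3_shift mP' m₁' m₂' bP' b₁' b₂' c₁ c₂ 0]

/-- `(g − c)⁶ ≤ 32·(g⁶ + c⁶)`. -/
private theorem sub_pow_six_le (g c : ℝ) : (g - c) ^ 6 ≤ 32 * (g ^ 6 + c ^ 6) := by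
  have h2 : (g - c) ^ 2 ≤ 2 * (g ^ 2 + c ^ 2) := by nlinarith [sq_nonneg (g + c)]
  have h0 : 0 ≤ (g - c) ^ 2 := sq_nonneg _
  have e : (g - c) ^ 6 = ((g - c) ^ 2) ^ 3 := by ring
  have h3 : ((g - c) ^ 2) ^ 3 ≤ (2 * (g ^ 2 + c ^ 2)) ^ 3 := pow_le_pow_left₀ h0 h2 3
  -- `(x + y)³ ≤ 4(x³ + y³)` for `x, y ≥ 0`
  have hx : 0 ≤ g ^ 2 := sq_nonneg g
  have hy : 0 ≤ c ^ 2 := sq_nonneg c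
  have h4 : (g ^ 2 + c ^ 2) ^ 3 ≤ 4 * ((g ^ 2) ^ 3 + (c ^ 2) ^ 3) := by
    nlinarith [mul_nonneg (mul_nonneg hx hy) (sq_nonneg (g ^ 2 - c ^ 2)), mul_nonneg (add_nonneg hx hy) (sq_nonneg (g ^ 2 - c ^ 2))]
  calc (g - c) ^ 6 = ((g - c) ^ 2) ^ 3 := e
    _ ≤ (2 * (g ^ 2 + c ^ 2)) ^ 3 := h3
    _ = 8 * (g ^ 2 + c ^ 2) ^ 3 := by ring
    _ ≤ 8 * (4 * ((g ^ 2) ^ 3 + (c ^ 2) ^ 3)) := by linarith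
    _ = 32 * (g ^ 6 + c ^ 6) := by ring

/-- Sixth moment of a re-centred observable from the sixth moment. -/
theorem integrable_sub_const_pow_six_mul_gaussWeight (hβ : 0 < β) {G : (LandauFree H → E3) → ℝ} (hG : Measurable G)
    (iG : Integrable (fun a => G a ^ 6 * gaussWeight β H a)) (c : ℝ) :
    Integrable (fun a => (G a - c) ^ 6 * gaussWeight β H a) := by
  have hdom : Integrable (fun a : LandauFree H → E3 => 32 * (G a ^ 6 + c ^ 6) * gaussWeight β H a) := by
    have hw := EdgeChartGaussian.integrable_gaussWeight H hβ
    exact ((iG.add (hw.const_mul (c ^ 6))).const_mul 32).congr (Filter.Eventually.of_forall fun a => by simp only [Pi.add_apply]; ring)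
  refine EdgeChartGaussian.integrable_mul_gaussWeight_of_abs_le H hβ ((hG.sub measurable_const).pow_const 6) hdom fun a => ?_
  rw [abs_of_nonneg (by positivity)]
  exact sub_pow_six_le (G a) c

/-- `E₀[G − E₀ G] = 0` (integrability from the square). -/
theorem gaussAvg_sub_gaussAvg_eq_zero (hβ : 0 < β) {G : (LandauFree H → E3) → ℝ} (hG : Measurable G)
    (hG2 : Integrable (fun a => G a ^ 2 * gaussWeight β H a)) : gaussAvg β H (fun a => G a - gaussAvg β H G) = 0 := by
  have hG1 := integrable_mul_gaussWeight_of_sq hβ hG hG2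
  have hw := EdgeChartGaussian.integrable_gaussWeight H hβ
  have hZ := EdgeChartGaussian.integral_gaussWeight_pos H hβ
  set m := gaussAvg β H G with hm
  have e : (fun a : LandauFree H → E3 => (G a - m) * gaussWeight β H a) = fun a => G a * gaussWeight β H a - m * gaussWeight β H a := by
    funext a; ring
  have hI : (∫ a : LandauFree H → E3, (G a - m) * gaussWeight β H a) = (∫ a, G a * gaussWeight β H a) - m * ∫ a, gaussWeight β H a := by
    rw [e, integral_sub hG1 (hw.const_mul m), integral_const_mul]
  unfold gaussAvg
  rw [hI, hm]
  unfold gaussAvg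
  field_simp
  ring

/-- ★★ **D-TRUNCATION TRANSFER FOR `κ₃,₀`, CENTRED FORM** (the shape of a connected three-point function: `E₀[X̃ỸZ̃]` with `X̃ = G₁ − E₀G₁`,
`Ỹ = G₂ − E₀G₂`, `Z̃ = P − E₀P`): under the hypotheses of ✓`abs_tiltCum3_muD_zero_sub_gaussCum3_le` with the sizes now bounding the CENTRED
monomials, `|Tilt.tiltCum3 μ_D P 0 G₁ G₂ − E₀[X̃ỸZ̃]| ≤ √τ·(4√A₁₂₃ + 12(√A₃√A₁₂ + √A₂√A₁₃ + √A₁√A₂₃) + 56·√A₁√A₂√A₃)`. -/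
theorem abs_tiltCum3_muD_zero_sub_gaussAvg_centred_le (hβ : 0 < β) (s : ℝ) {τ : ℝ} (hτ : gaussAvg β H (fun a => 1 - sfInd H s a) ≤ τ)
    (hτ2 : τ ≤ 1 / 2) {G₁ G₂ P : (LandauFree H → E3) → ℝ} (h₁ : Measurable G₁) (h₂ : Measurable G₂) (hP : Measurable P) {B : ℝ}
    (hB : 0 ≤ B) (h₁D : ∀ a ∈ smallField H s, |G₁ a| ≤ B) (h₂D : ∀ a ∈ smallField H s, |G₂ a| ≤ B)
    (hPD : ∀ a ∈ smallField H s, |P a| ≤ B) (i₁ : Integrable (fun a => G₁ a ^ 6 * gaussWeight β H a))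
    (i₂ : Integrable (fun a => G₂ a ^ 6 * gaussWeight β H a)) (iP : Integrable (fun a => P a ^ 6 * gaussWeight β H a))
    {A₁ A₂ A₃ A₁₂ A₁₃ A₂₃ A₁₂₃ : ℝ} (hA₁ : gaussAvg β H (fun a => (G₁ a - gaussAvg β H G₁) ^ 2) ≤ A₁)
    (hA₂ : gaussAvg β H (fun a => (G₂ a - gaussAvg β H G₂) ^ 2) ≤ A₂) (hA₃ : gaussAvg β H (fun a => (P a - gaussAvg β H P) ^ 2) ≤ A₃)
    (hA₁₂ : gaussAvg β H (fun a => ((G₁ a - gaussAvg β H G₁) * (G₂ a - gaussAvg β H G₂)) ^ 2) ≤ A₁₂)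
    (hA₁₃ : gaussAvg β H (fun a => ((G₁ a - gaussAvg β H G₁) * (P a - gaussAvg β H P)) ^ 2) ≤ A₁₃)
    (hA₂₃ : gaussAvg β H (fun a => ((G₂ a - gaussAvg β H G₂) * (P a - gaussAvg β H P)) ^ 2) ≤ A₂₃)
    (hA₁₂₃ : gaussAvg β H (fun a => ((G₁ a - gaussAvg β H G₁) * (G₂ a - gaussAvg β H G₂) * (P a - gaussAvg β H P)) ^ 2) ≤ A₁₂₃) :
    |Tilt.tiltCum3 (((volume : Measure (LandauFree H → E3)).restrict (smallField H s)).withDensity fun a => ENNReal.ofReal (gaussWeight β H a))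
          P 0 G₁ G₂ -
        gaussAvg β H (fun a => (G₁ a - gaussAvg β H G₁) * (G₂ a - gaussAvg β H G₂) * (P a - gaussAvg β H P))| ≤
      Real.sqrt τ * (4 * Real.sqrt A₁₂₃ + 12 * (Real.sqrt A₃ * Real.sqrt A₁₂ + Real.sqrt A₂ * Real.sqrt A₁₃ + Real.sqrt A₁ * Real.sqrt A₂₃) +
        56 * (Real.sqrt A₁ * Real.sqrt A₂ * Real.sqrt A₃)) := by
  have hD := integral_sfInd_mul_gaussWeight_pos hβ s hτ hτ2
  set m₁ := gaussAvg β H G₁ with hm₁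
  set m₂ := gaussAvg β H G₂ with hm₂
  set b := gaussAvg β H P with hb
  rw [tiltCum3_muD_zero_shift hβ s hD h₁ h₂ hP hB h₁D h₂D hPD m₁ m₂ b]
  -- the re-centred observables: measurable, bounded on `D`, sixth moments
  have hX : Measurable fun a => G₁ a - m₁ := h₁.sub measurable_const
  have hY : Measurable fun a => G₂ a - m₂ := h₂.sub measurable_const
  have hZ : Measurable fun a => P a - b := hP.sub measurable_const
  have hB' : 0 ≤ B + (|m₁| + |m₂| + |b|) := by positivity
  have hXD : ∀ a ∈ smallField H s, |G₁ a - m₁| ≤ B + (|m₁| + |m₂| + |b|) := fun a ha =>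
    (abs_sub _ _).trans (by linarith [h₁D a ha, abs_nonneg m₂, abs_nonneg b])
  have hYD : ∀ a ∈ smallField H s, |G₂ a - m₂| ≤ B + (|m₁| + |m₂| + |b|) := fun a ha =>
    (abs_sub _ _).trans (by linarith [h₂D a ha, abs_nonneg m₁, abs_nonneg b])
  have hZD : ∀ a ∈ smallField H s, |P a - b| ≤ B + (|m₁| + |m₂| + |b|) := fun a ha =>
    (abs_sub _ _).trans (by linarith [hPD a ha, abs_nonneg m₁, abs_nonneg m₂])
  have iX := integrable_sub_const_pow_six_mul_gaussWeight hβ h₁ i₁ m₁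
  have iY := integrable_sub_const_pow_six_mul_gaussWeight hβ h₂ i₂ m₂
  have iZ := integrable_sub_const_pow_six_mul_gaussWeight hβ hP iP b
  have key := abs_tiltCum3_muD_zero_sub_gaussCum3_le hβ s hτ hτ2 hX hY hZ hB' hXD hYD hZD iX iY iZ hA₁ hA₂ hA₃ hA₁₂ hA₁₃ hA₂₃ hA₁₂₃
  -- the centred slots have zero mean
  have z₁ : gaussAvg β H (fun a => G₁ a - m₁) = 0 := gaussAvg_sub_gaussAvg_eq_zero hβ h₁ (integrable_sq_mul_gaussWeight_of_six hβ h₁ i₁)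
  have z₂ : gaussAvg β H (fun a => G₂ a - m₂) = 0 := gaussAvg_sub_gaussAvg_eq_zero hβ h₂ (integrable_sq_mul_gaussWeight_of_six hβ h₂ i₂)
  have z₃ : gaussAvg β H (fun a => P a - b) = 0 := gaussAvg_sub_gaussAvg_eq_zero hβ hP (integrable_sq_mul_gaussWeight_of_six hβ hP iP)
  simp only [z₁, z₂, z₃, zero_mul, mul_zero, sub_zero, add_zero] at key
  exact key

end GaussRestrict

end Summit.QuantumFields.YangMills.Theorems.AllWindowsColdBoxBoxHighLine

end
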